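import Summits.ABC.IUTFork.Cor312VolumesPadicSummands
import HarnessLib

/-!
# [IUTchIII] Corollary 3.12, statement — the verbatim container at a finite prime: the permutation part of
# (Ind1) and the generator facts assembled

Record-only file (D-0012) of the abc-iut cell (Cor. 3.12 sub-crew, seat abc-iut-c312-5, gen 2; D-0067 TEAM A row
A-0); TAKES NO SIDE. Companion of `Cor312VolumesPadicSummands` (the verbatim mono-analytic container of
[IUTchIII] Rmk. 3.1.1 (ii)(iii), kurims `paper:url-4b091feeb646` pp. 94–96, on abc-iut-c312-3's REAL prime packets
`X_{v⃗} = K_{v_0} ⊗_{ℚ_p} ⋯ ⊗_{ℚ_p} K_{v_j}` over a `p`-adic presentation of c312-1's log-shell carriers; there: the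
comparison `e`, the local pieces, and the (Ind2)/strip generator facts). HERE: the PERMUTATION part of (Ind1) —
c312-1's `LogShells.permute σ` (capsule permutation, [IUTchIII] Thm. 3.11 (i) (Ind1); Dupuy–Hilado §4.7 "the
action of Ind1 … is simultaneous") is intertwined by `e` with the SUMMAND PERMUTATION `(Ψ y)_{v⃗} = perm_σ(y_{v⃗∘σ})`
(`permΨ`; `perm_σ` = c312-3's `permLinearEquiv`), which carries direct product regions to direct product regions
(factors transported by `perm_σ`, preserving `PacketAdm`/`log μ̄`: c312-3's `packetAdm_image_perm`,
`packetLogμ_image_perm` — Haar transport THEOREMS) of the same weighted log-volume, the weights being symmetric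
([IUTchIII] Prop. 3.9 (i) p. 116 "`μ^log_{A,v_ℚ}` is invariant with respect to permutations of `A`") —
`perm_preserves`; whence `generatorsPreserve_toLocalPieces`: c312-5's hypothesis structure `GeneratorsPreserve`
(`Cor312VolumesLocal`) HOLDS for the real prime packets, so that (`generatorsPreserve_ofLocal`,
`adm_and_logvol_eq_of_mem_indGroup`, `Cor312VolumesSummandsBridge`) along the whole indeterminacy subgroup of
(Ind1), (Ind2) admissible regions keep their log-volume and every possible image of the Θ-pilot object is
admissible with the Θ-region's log-volume (proof of Cor. 3.12, Step (x), p. 181). [claim: Mochizuki2012, status: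
disputed] for the quoted container; [cite: DupuyHilado2025, §4.7]; every theorem is bookkeeping over PROVED
transport theorems. Deliberately NOT here: concrete presentations (c312-5 `Real.*`), Θ-boxes, archimedean places,
any judgement.
-/

noncomputable section

open Set Function PiTensorProduct
open scoped TensorProduct Pointwise

namespace Summit.ABC

namespace IUTFork

namespace Cor312Vol

open Thm311 Literature.IUT.LogThetaLattice Literature.IUT.LogVolume Literature.LinearAlgebra.BaseChange

variable {T : ThetaIndex}

namespace PadicPresentation

variable {L : LogShells T} {vQ : T.VQ} {p : ℕ} [Fact p.Prime] (P : PadicPresentation L vQ p)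

/-! ## The permutation part of (Ind1): permuting the summands -/

section Perm

variable {j : T.Label}

/-- Re-indexing the summands `v⃗ ↦ v⃗ ∘ σ` (a capsule permutation acts on the tuples). [folklore] -/
def tupleReindex (vQ : T.VQ) (σ : Equiv.Perm (T.Caps j)) : (T.Caps j → T.Fibre vQ) ≃ (T.Caps j → T.Fibre vQ) where
  toFun e := e ∘ σ
  invFun e := e ∘ σ.symm
  left_inv e := funext fun a => by simp
  right_inv e := funext fun a => by simp

/-- abc-iut-c312-3's factor permutation `perm_σ : K_{v_{σ 0}} ⊗ ⋯ ⊗ K_{v_{σ j}} ≃ K_{v_0} ⊗ ⋯ ⊗ K_{v_j}`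
(`permLinearEquiv`) with its source typed as the summand `X_{v⃗∘σ}`. [cite: DupuyHilado2025, §4.7] -/
def permX (σ : Equiv.Perm (T.Caps j)) (e : T.Caps j → T.Fibre vQ) : P.X (e ∘ σ) ≃ₗ[ℚ_[p]] P.X e :=
  permLinearEquiv p (P.kk e) σ

/-- `permX` IS `permLinearEquiv` (as functions). [folklore] -/
theorem permX_apply (σ : Equiv.Perm (T.Caps j)) (e : T.Caps j → T.Fibre vQ) (x : P.X (e ∘ σ)) :
    P.permX σ e x = permLinearEquiv p (P.kk e) σ x := rfl

/-- **The summand permutation** realising `permute σ` on `Π_{v⃗} X_{v⃗}`: `(Ψ y)_{v⃗} = perm_σ(y_{v⃗∘σ})`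
(Dupuy–Hilado §4.7: (Ind1) acts "simultaneously" on the tuples). [cite: DupuyHilado2025, §4.7] -/
def permΨ (σ : Equiv.Perm (T.Caps j)) :
    (∀ e : T.Caps j → T.Fibre vQ, P.X e) ≃ ∀ e : T.Caps j → T.Fibre vQ, P.X e :=
  (Equiv.piCongrLeft' (fun e => P.X e) (tupleReindex vQ σ).symm).trans
    (Equiv.piCongrRight fun e => (P.permX σ e).toEquiv)

/-- `(Ψ y)_{v⃗} = perm_σ(y_{v⃗∘σ})`. [folklore] -/
theorem permΨ_apply (σ : Equiv.Perm (T.Caps j)) (y : ∀ e : T.Caps j → T.Fibre vQ, P.X e)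
    (e : T.Caps j → T.Fibre vQ) : P.permΨ σ y e = P.permX σ e (y (e ∘ σ)) := rfl

/-- `Ψ(Π_{v⃗} R_{v⃗}) = Π_{v⃗} perm_σ(R_{v⃗∘σ})`. [folklore] -/
theorem permΨ_image_pi (σ : Equiv.Perm (T.Caps j)) (R : ∀ e : T.Caps j → T.Fibre vQ, Set (P.X e)) :
    P.permΨ σ '' Set.pi univ R = Set.pi univ fun e => P.permX σ e '' R (e ∘ σ) := by
  apply Set.Subset.antisymm
  · rintro _ ⟨y, hy, rfl⟩ e -
    exact ⟨y (e ∘ σ), hy _ (Set.mem_univ _), rfl⟩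
  · intro z hz
    refine ⟨(P.permΨ σ).symm z, fun u _ => ?_, (P.permΨ σ).apply_symm_apply z⟩
    obtain ⟨e, rfl⟩ := (tupleReindex vQ σ).surjective u
    obtain ⟨r, hr, hre⟩ := hz e (Set.mem_univ _)
    have h := congrFun ((P.permΨ σ).apply_symm_apply z) e
    rw [permΨ_apply, ← hre] at h
    have h' := (P.permX σ e).injective h
    show (P.permΨ σ).symm z (e ∘ σ) ∈ R (e ∘ σ)
    rw [h']
    exact hr

/-- The `v⃗∘σ`-coordinates of `Ψ⁻¹(Π R)` are `perm_σ⁻¹(R_{v⃗})`. [folklore] -/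
theorem eval_image_permΨ_preimage_pi (σ : Equiv.Perm (T.Caps j)) (R : ∀ e : T.Caps j → T.Fibre vQ, Set (P.X e))
    (hR : ∀ e, (R e).Nonempty) (e : T.Caps j → T.Fibre vQ) :
    (fun y : ∀ e, P.X e => y (e ∘ σ)) '' (P.permΨ σ ⁻¹' Set.pi univ R) =
      (P.permX σ e).symm '' R e := by
  classical
  apply Set.Subset.antisymm
  · rintro _ ⟨y, hy, rfl⟩
    have h := hy e (Set.mem_univ _)
    rw [permΨ_apply] at h
    exact ⟨_, h, (P.permX σ e).symm_apply_apply _⟩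
  · rintro _ ⟨r, hr, rfl⟩
    obtain ⟨z₀, hz₀⟩ := Set.univ_pi_nonempty_iff.2 hR
    let z : ∀ e, P.X e := Function.update z₀ e r
    have hz : z ∈ Set.pi univ R := fun e' _ => by
      by_cases h : e' = e
      · subst h; simp [z, hr]
      · simp only [z, Function.update_of_ne h]; exact hz₀ e' (Set.mem_univ _)
    refine ⟨(P.permΨ σ).symm z, by rw [Set.mem_preimage, Equiv.apply_symm_apply]; exact hz, ?_⟩
    have h := congrFun ((P.permΨ σ).apply_symm_apply z) e
    rw [permΨ_apply] at h
    have h' := congrArg (P.permX σ e).symm h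
    rw [LinearEquiv.symm_apply_apply] at h'
    change (P.permΨ σ).symm z (e ∘ σ) = _
    rw [h']
    simp [z]

/-- A preimage of a product set under a map reading each coordinate through one coordinate is the product of
its coordinate projections. [folklore] -/
theorem preimage_pi_eq_pi_eval {ι : Type*} {α β : ι → Type*} (g : ι → ι) (G : ∀ i, α (g i) → β i)
    (t : ∀ i, Set (β i)) :
    (fun (y : ∀ i, α i) i => G i (y (g i))) ⁻¹' Set.pi univ t =
      Set.pi univ fun i => (fun y : ∀ i, α i => y i) ''
        ((fun (y : ∀ i, α i) i => G i (y (g i))) ⁻¹' Set.pi univ t) := by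
  apply Set.Subset.antisymm (Set.subset_pi_eval_image _ _)
  intro y hy i _
  obtain ⟨y', hy', hyy'⟩ := hy (g i) (Set.mem_univ _)
  have h1 : G i (y' (g i)) ∈ t i := hy' i (Set.mem_univ _)
  have h2 : y' (g i) = y (g i) := hyy'
  show G i (y (g i)) ∈ t i
  rw [← h2]
  exact h1

/-- **The permutation part of (Ind1) preserves the verbatim container** at `v_ℚ = p`: `permute σ` is intertwined
with the summand permutation `Ψ`, which carries direct product regions to direct product regions (factors
transported by `perm_σ`, which preserves `PacketAdm`/`log μ̄` — abc-iut-c312-3 `packetAdm_image_perm`,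
`packetLogμ_image_perm`) of the same weighted log-volume (symmetric weights, [IUTchIII] Prop. 3.9 (i) p. 116).
[cite: DupuyHilado2025, §4.7] -/
theorem perm_preserves (σ : Equiv.Perm (T.Caps j)) :
    ∃ Ψ, P.toLocalPieces.PreservesRegions j Ψ ∧ ∀ x, P.comparison j (L.permute j vQ σ x) = Ψ (P.comparison j x) := by
  classical
  haveI : Nonempty (T.Caps j) := ⟨0⟩
  letI : Fintype (T.Caps j → T.Fibre vQ) := Fintype.ofFinite _
  -- transport of volumes along `perm_σ` and `perm_σ⁻¹`
  have hvol : ∀ (e : T.Caps j → T.Fibre vQ) (A : Set (P.X (e ∘ σ))),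
      packetVol p (P.kk e) (P.permX σ e '' A) = packetVol p (P.kk (e ∘ σ)) A :=
    fun e A => packetVol_image_perm p (P.kk e) σ A
  have hvol' : ∀ (e : T.Caps j → T.Fibre vQ) (B : Set (P.X e)),
      packetVol p (P.kk (e ∘ σ)) ((P.permX σ e).symm '' B) = packetVol p (P.kk e) B := by
    intro e B
    have h := hvol e ((P.permX σ e).symm '' B)
    rw [Set.image_image] at h
    simp only [LinearEquiv.apply_symm_apply, Set.image_id'] at h
    exact h.symm
  have hlog : ∀ (e : T.Caps j → T.Fibre vQ) (A : Set (P.X (e ∘ σ))),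
      packetLogμ p (P.kk e) (P.permX σ e '' A) = packetLogμ p (P.kk (e ∘ σ)) A :=
    fun e A => packetLogμ_image_perm p (P.kk e) σ A
  have hlog' : ∀ (e : T.Caps j → T.Fibre vQ) (B : Set (P.X e)),
      packetLogμ p (P.kk (e ∘ σ)) ((P.permX σ e).symm '' B) = packetLogμ p (P.kk e) B := by
    intro e B
    have h := hlog e ((P.permX σ e).symm '' B)
    rw [Set.image_image] at h
    simp only [LinearEquiv.apply_symm_apply, Set.image_id'] at h
    exact h.symm
  refine ⟨P.permΨ σ, ⟨(P.permΨ σ).bijective, fun R hR => ?_, fun R hR => ?_⟩, fun x => ?_⟩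
  · -- images of direct product regions
    refine ⟨fun e => P.permX σ e '' R (e ∘ σ), P.permΨ_image_pi σ R, fun e => ?_, ?_⟩
    · have h := hR (e ∘ σ)
      change PacketAdm p (P.kk (e ∘ σ)) (R (e ∘ σ)) at h
      show PacketAdm p (P.kk e) (P.permX σ e '' R (e ∘ σ))
      unfold PacketAdm at h ⊢
      rw [hvol e]
      exact h
    · show ∑ e, P.w j e * packetLogμ p (P.kk e) (P.permX σ e '' R (e ∘ σ)) =
        ∑ e, P.w j e * packetLogμ p (P.kk e) (R e)
      simp_rw [hlog]
      calc ∑ e, P.w j e * packetLogμ p (P.kk (e ∘ σ)) (R (e ∘ σ))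
          = ∑ e, P.w j (tupleReindex vQ σ e) * packetLogμ p (P.kk (tupleReindex vQ σ e)) (R (tupleReindex vQ σ e)) :=
            Finset.sum_congr rfl fun e _ => by rw [show tupleReindex vQ σ e = e ∘ σ from rfl, P.w_perm]
        _ = ∑ e, P.w j e * packetLogμ p (P.kk e) (R e) :=
            Equiv.sum_comp (tupleReindex vQ σ) (fun e => P.w j e * packetLogμ p (P.kk e) (R e))
  · -- preimages of direct product regions
    have hne : ∀ e, (R e).Nonempty := fun e => P.packetAdm_nonempty e _ (hR e)
    set R' : ∀ e : T.Caps j → T.Fibre vQ, Set (P.X e) :=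
      fun e => (fun y : ∀ e, P.X e => y e) '' (P.permΨ σ ⁻¹' Set.pi univ R) with hR'
    have hpre : (P.permΨ σ : (∀ e, P.X e) → ∀ e, P.X e) ⁻¹' Set.pi univ R = Set.pi univ R' :=
      preimage_pi_eq_pi_eval (fun e => e ∘ σ) (fun e => ⇑(P.permX σ e)) R
    have hR'eq : ∀ e, R' (e ∘ σ) = (P.permX σ e).symm '' R e :=
      fun e => P.eval_image_permΨ_preimage_pi σ R hne e
    refine ⟨R', hpre, fun u => ?_, ?_⟩
    · obtain ⟨e, rfl⟩ := (tupleReindex vQ σ).surjective u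
      show PacketAdm p (P.kk (e ∘ σ)) (R' (e ∘ σ))
      rw [hR'eq e]
      have h := hR e
      change PacketAdm p (P.kk e) (R e) at h
      unfold PacketAdm at h ⊢
      rw [hvol' e]
      exact h
    · show ∑ e, P.w j e * packetLogμ p (P.kk e) (R' e) = ∑ e, P.w j e * packetLogμ p (P.kk e) (R e)
      calc ∑ e, P.w j e * packetLogμ p (P.kk e) (R' e)
          = ∑ e, P.w j (tupleReindex vQ σ e) * packetLogμ p (P.kk (tupleReindex vQ σ e)) (R' (tupleReindex vQ σ e)) :=
            (Equiv.sum_comp (tupleReindex vQ σ) (fun e => P.w j e * packetLogμ p (P.kk e) (R' e))).symm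
        _ = ∑ e, P.w j e * packetLogμ p (P.kk e) (R e) :=
            Finset.sum_congr rfl fun e _ => by
              rw [show tupleReindex vQ σ e = e ∘ σ from rfl, P.w_perm, hR'eq e, hlog' e]
  · -- naturality
    funext e
    have key : (LinearMap.proj e ∘ₗ P.comparison j) ∘ₗ (L.permute j vQ σ).toLinearMap =
        ((P.permX σ e).toLinearMap.restrictScalars ℚ) ∘ₗ
          (LinearMap.proj (e ∘ σ) ∘ₗ P.comparison j) := by
      refine PiTensorProduct.ext (MultilinearMap.ext fun y => ?_)
      simp only [LinearMap.compMultilinearMap_apply]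
      change P.comparison j (L.permute j vQ σ (L.tprod j vQ y)) e =
        P.permX σ e (P.comparison j (tprod ℚ y) (e ∘ σ))
      rw [L.permute_tprod]
      change P.comparison j (tprod ℚ fun i => y (σ.symm i)) e = _
      rw [comparison_tprod, comparison_tprod]
      change _ = P.permX σ e (tprod ℚ_[p] fun a => (P.φ (e (σ a))) (y a (e (σ a))))
      rw [permX_apply]
      refine Eq.trans (congrArg _ (funext fun b => ?_))
        (permLinearEquiv_tprod p (P.kk e) σ fun a => P.φ (e (σ a)) (y a (e (σ a)))).symm
      obtain ⟨a, rfl⟩ := σ.surjective b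
      rw [Equiv.piCongrLeft_apply_apply, Equiv.symm_apply_apply]
    exact LinearMap.congr_fun key x

end Perm

/-! ## The generator hypotheses, proved -/

/-- **`GeneratorsPreserve` for the REAL prime packets**: at `v_ℚ = p`, every capsule permutation, every
factor-and-summand-wise family of strip-automorphisms and every such family of `Ism`-elements is intertwined by
the comparison with a map preserving the verbatim container (direct product regions over the summands, weighted
log-volumes). Hence (`generatorsPreserve_ofLocal`, `adm_and_logvol_eq_of_mem_indGroup`,
`Cor312VolumesSummandsBridge`) along the whole indeterminacy subgroup admissible regions keep their log-volume and
every possible image of the Θ-pilot object is admissible. [cite: DupuyHilado2025, §4.7, §4.9] -/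
theorem generatorsPreserve_toLocalPieces : P.toLocalPieces.GeneratorsPreserve :=
  ⟨fun _ σ => P.perm_preserves σ, fun _ g hg => P.strip_preserves g hg, fun _ g hg => P.ism_preserves g hg⟩

end PadicPresentation

end Cor312Vol

end IUTFork

end Summit.ABC

end
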